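import Literature.Barriers.PneNP.MatchingSlackPsdSupportBarrier
import Literature.Combinatorics.AssociationSchemes.HomogeneousMatchingFamilies
import HarnessLib

/-!
# An explicit psd fooling set of size `C(n/2 − 1, 2)` in Edmonds' odd-cut slack matrix:
# the support barrier `C(n,2) + 1` is attained up to the constant `4`

Companion to `MatchingSlackPsdSupportBarrier.lean`. There, FGPRT §5.2 [FawziEtAl2015, §5.2 (p15);
Thm. 2.9 (v) (p06–p07)] is specialised to the odd-cut slack matrix `S_{UM} = |δ(U) ∩ M| − 1` of the
perfect matching polytope of `K_n` (`pmOddCutSlack n`, rows `OddSet n`, columns `PMatch n`) and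
PROVED: every SUPPORT-BASED psd-rank lower bound `R` (`IsSupportBasedPsdBound n R`: all nonnegative
matrices with the zero pattern of `S` have psd rank `≥ R`) satisfies `R ≤ C(n,2) + 1`
(`supportBasedPsdBound_le`). This file proves the CONVERSE HALF by an explicit construction: for
`n = 2m` the odd-cut slack matrix contains a triangular pattern ("psd fooling set", the hypothesis of
the tree's `HasPsdFactorization.card_le_of_triangular` = [FawziEtAl2015, Thm. 2.10 + Ex. 2.11 (p07)])
of size `C(m − 1, 2)`, so support-based arguments DO certify `Ω(n²)` and, unconditionally,

  `rk_psd(S_odd(K_{2m})) ≥ C(m − 1, 2)`   (`choose_two_le_of_hasPsdFactorization`),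

with no description (Edmonds' or otherwise) of the matching polytope used. Everything is proved;
there is no named fact.

## The construction (vertex labels `0, …, 2m − 1`)
* Columns. `M₀ = {01, 23, 45, …}`; for `a < b < m` the matching `R(a,b)` (`rotMatch m a b`) re-matches
  the block of labels `2a, …, 2b+1` as `{2a+1,2a+2}, {2a+3,2a+4}, …, {2b−1,2b}` plus the long edge
  `{2a, 2b+1}` and agrees with `M₀` elsewhere (partner map `rotFun a b`, an explicit fixed-point-free
  involution; the matching is its edge set `edgesOf`, `HomogeneousMatchingFamilies` §1).
* Rows. `U(p,q) = {2p+1, …, 2q+1}` (`oddIvl m p q`), odd of size `2(q−p)+1 ∈ [3, 2m−3]` for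
  `0 ≤ p < q ≤ m − 2` — genuine Edmonds odd-set constraints.
* Crossing numbers (§3). `|δ(U(p,q)) ∩ R(a,b)| = 3` if `p < a ≤ q < b` (the labels `2p+1`, `2a`, `2q+1`
  are matched outside `U`; we only use `≥ 2`, `two_le_cc_oddIvl_rotMatch`) and `= 1` otherwise
  (`cc_oddIvl_rotMatch_eq_one`: the unique label of `U` matched outside is `exitVertex a b p q`; five
  relative positions of the interval and the block, all discharged by `omega` on the label arithmetic).
* Pattern. Row `U(p,q)` is paired with column `R(p+1, q+1)` (slack `2 ≠ 0`); if `(p', q')` is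
  lexicographically SMALLER than `(p, q)` then `¬(p ≤ p' ∧ p' < q ∧ q ≤ q')`, so `R(p'+1,q'+1)` is tight on
  `U(p,q)` (slack `0`). Ordering the `C(m−1, 2)` pairs decreasingly gives the triangular pattern; the
  order is implemented by the injective code `q + (m−1)·p`, monotone in both coordinates
  (`card_le_of_triangular_code`, the fooling-set bound indexed by a coded finite set).

## Main statements
* `isSupportBasedPsdBound_choose_two m : IsSupportBasedPsdBound (2m) (C(m−1,2))`;
* `choose_two_le_of_hasPsdFactorization : HasPsdFactorization (pmOddCutSlack (2m)) r → C(m−1,2) ≤ r`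
  (and the `Even n` form `choose_two_le_of_hasPsdFactorization_even`, bound `C(n/2 − 1, 2)`);
* `supportBased_window m`: the support-based technique class for Edmonds' slack matrix certifies
  `C(m−1,2) ≈ n²/8` and never more than `C(n,2) + 1 ≈ n²/2`;
* §6 sharpens the ceiling to the dimension bound: `rank_pmOddCutSlack_le` (`rank S ≤ C(n,2) + 1 − n`,
  from the `n` independent degree relations among the rows of the column factor `1[e ∈ M] ⊕ 1`),
  `supportBasedPsdBound_le_dim` (`R ≤ C(n,2) + 1 − n = dim P_PM(K_n) + 1` for every support-based `R`,
  `n ≥ 3`) and `supportBased_window_dim` (`m ≥ 2`): the window is `[C(m−1,2), C(2m,2) − 2m + 1]`,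
  i.e. between a quarter of the dimension bound and the dimension bound itself.

Context, honestly. For the FULL slack matrix of a polytope `P` (all facet rows), print gives
`rk_psd ≥ dim P + 1` [GouveiaRobinsonThomas2013, Prop. 3.2] = [FawziEtAl2015, Cor. 5.9] — in the tree
as `FawziEtAl2015_cor59_holds`, usable for the matching polytope only together with Edmonds'
H-description (in the tree since `PerfectMatchingPolytope.lean`; the resulting bound
`rk_psd ≥ C(n,2) − n + 1` for the FULL Edmonds slack matrix of `K_n` is PROVED in
`Literature/Combinatorics/Optimization/PerfectMatchingPolytopeDimension.lean`,
`PMPolytopeDim.choose_two_sub_add_one_le_of_hasPsdFactorization`, with `dim P_PM(K_n) = C(n,2) − n` =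
`PMPolytopeDim.finrank_dirSpace`); that bound concerns the slack matrix WITH the `C(n,2)`
edge-nonnegativity rows. For the odd-cut block alone
(the object of the cell's crux `TracialDecayExp20` and of both barrier files) no lower bound was
recorded in the tree before this file. presearch (2026-08-27, corpus fts+vec `lit search --hybrid` /
`lit vsearch` "fooling set / triangular submatrix / support-based psd rank lower bound for the matching
polytope", galaxy `psd fooling|fooling set bound for psd|…`, `psd rank of the (perfect) matching
polytope|semidefinite rank of the matching`, `extension complexity of the matching polytope|…`):
nothing on explicit fooling sets in Edmonds' slack matrix; the construction is elementary and is
recorded as ours [folklore-level]. Small-`n` data (seat-local search, seconds; not of record): the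
longest triangular pattern in the odd-cut slack matrix of `K_6` has size exactly `5` (exhaustive), and
greedy chains of sizes `9`, `14` exist for `K_8`, `K_10` — same leading term `m²/2` as `C(m−1,2)`.

Label: instrument — an unconditional but POLYNOMIAL floor and the calibration of one technique class.
WHAT THIS IS NOT: no progress on the exponential crux (stmt-PneNP-19878) or on the FGPRT open problem
beyond `Ω(n²)`; not the dimension bound for the full slack matrix (Edmonds' theorem is not used or
proved); nothing about nonnegative rank (Rothvoß) and no P-vs-NP content.
-/

noncomputable section

open Finset Equiv

namespace Literature.Barriers.PneNP

open Literature.Combinatorics.Optimization (HasPsdFactorization)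
open Literature.Combinatorics.SimpleGraph.CycleSpace (Crosses crosses_mk)
open Literature.Combinatorics.AssociationSchemes.HomogeneousMatchingFamilies
  (edgesOf mem_edgesOf mk_mem_edgesOf_iff isPMOn_edgesOf)
open Literature.Combinatorics.AssociationSchemes.MatchingLevelInequality (fpfInvolutions mem_fpfInvolutions)

namespace PsdFoolingSet

/-! ### §0 Two pieces of plumbing -/

/-- The psd fooling-set bound indexed by a finite set carrying an injective `ℕ`-code instead of `Fin K`:
if `M (ρ x) (γ x) ≠ 0` for `x ∈ P` and `M (ρ x) (γ y) = 0` whenever `code y < code x`, then every psd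
factorisation of `M` has size `≥ |P|` (enumerate the codes increasingly and reverse).
[cite: FawziEtAl2015, Thm. 2.10 + Ex. 2.11 (p07, corollary)] -/
theorem card_le_of_triangular_code {ι κ σ : Type*} [Nonempty σ] {M : ι → κ → ℝ} {k : ℕ}
    (h : HasPsdFactorization M k) (P : Finset σ) (code : σ → ℕ) (hinj : Set.InjOn code ↑P)
    (ρ : σ → ι) (γ : σ → κ) (hdiag : ∀ x ∈ P, M (ρ x) (γ x) ≠ 0)
    (hoff : ∀ x ∈ P, ∀ y ∈ P, code y < code x → M (ρ x) (γ y) = 0) : P.card ≤ k := by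
  classical
  set T : Finset ℕ := P.image code with hT
  have hTcard : T.card = P.card := Finset.card_image_of_injOn hinj
  let e : Fin T.card ↪o ℕ := T.orderEmbOfFin rfl
  let dec : ℕ → σ := Function.invFunOn code ↑P
  have hdec : ∀ i, dec (e i) ∈ P ∧ code (dec (e i)) = e i := by
    intro i
    have hi : e i ∈ T := T.orderEmbOfFin_mem rfl i
    obtain ⟨x, hx, hxe⟩ := Finset.mem_image.1 hi
    have hex : ∃ x ∈ (↑P : Set σ), code x = e i := ⟨x, hx, hxe⟩
    exact ⟨Function.invFunOn_mem hex, Function.invFunOn_eq hex⟩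
  have key := h.card_le_of_triangular (fun a => ρ (dec (e (Fin.rev a))))
    (fun a => γ (dec (e (Fin.rev a)))) (fun a => hdiag _ (hdec _).1) (fun a b hab =>
      hoff _ (hdec _).1 _ (hdec _).1 (by
        rw [(hdec _).2, (hdec _).2]
        exact e.strictMono (Fin.rev_lt_rev.2 hab)))
  rwa [hTcard] at key

variable {n : ℕ}

/-- `π (π x) = x` for a fixed-point-free involution. [folklore] -/
private theorem fpf_apply_apply {π : Perm (Fin n)} (hπ : π ∈ fpfInvolutions n) (x : Fin n) :
    π (π x) = x := by
  have h := (mem_fpfInvolutions.1 hπ).1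
  rw [← Perm.mul_apply, h, Perm.one_apply]

/-- If `v` is the ONLY vertex of `U` matched outside `U` by the fixed-point-free involution `π`, the
edges of the matching `edgesOf π` crossing `U` are exactly `{v, π v}`. [folklore] -/
private theorem filter_crosses_edgesOf_eq {π : Perm (Fin n)} (hπ : π ∈ fpfInvolutions n) (U : Finset (Fin n))
    {v : Fin n} (hv : v ∈ U) (hπv : π v ∉ U) (huniq : ∀ x ∈ U, π x ∉ U → x = v) :
    (edgesOf π).filter (Crosses U) = {s(v, π v)} := by
  ext e
  simp only [Finset.mem_filter, Finset.mem_singleton]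
  constructor
  · rintro ⟨he, hc⟩
    obtain ⟨x, rfl⟩ := mem_edgesOf.1 he
    rw [crosses_mk] at hc
    rcases hc with ⟨hx, hπx⟩ | ⟨hx, hπx⟩
    · rw [huniq x hx hπx]
    · have hxx : π (π x) = x := fpf_apply_apply hπ x
      have hv' : π x = v := huniq (π x) hπx (by rwa [hxx])
      rw [Sym2.eq_swap, ← hv', hxx]
  · rintro rfl
    exact ⟨(mk_mem_edgesOf_iff hπ).2 rfl, (crosses_mk _ _ _).2 (Or.inl ⟨hv, hπv⟩)⟩

/-- Two distinct vertices of `U` matched outside `U` give two crossing edges. [folklore] -/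
private theorem two_le_card_filter_crosses_edgesOf {π : Perm (Fin n)} (hπ : π ∈ fpfInvolutions n)
    (U : Finset (Fin n)) {x y : Fin n} (hx : x ∈ U) (hy : y ∈ U) (hxy : x ≠ y) (hπx : π x ∉ U)
    (hπy : π y ∉ U) : 2 ≤ ((edgesOf π).filter (Crosses U)).card := by
  have hsub : ({s(x, π x), s(y, π y)} : Finset (Sym2 (Fin n))) ⊆ (edgesOf π).filter (Crosses U) := by
    intro e he
    simp only [Finset.mem_insert, Finset.mem_singleton] at he
    rw [Finset.mem_filter]
    rcases he with rfl | rfl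
    · exact ⟨(mk_mem_edgesOf_iff hπ).2 rfl, (crosses_mk _ _ _).2 (Or.inl ⟨hx, hπx⟩)⟩
    · exact ⟨(mk_mem_edgesOf_iff hπ).2 rfl, (crosses_mk _ _ _).2 (Or.inl ⟨hy, hπy⟩)⟩
  have hne : s(x, π x) ≠ s(y, π y) := by
    intro h
    rcases Sym2.eq_iff.1 h with ⟨h1, _⟩ | ⟨h1, _⟩
    · exact hxy h1
    · exact hπy (h1 ▸ hx)
  calc 2 = ({s(x, π x), s(y, π y)} : Finset (Sym2 (Fin n))).card := by rw [Finset.card_pair hne]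
    _ ≤ _ := Finset.card_le_card hsub

/-! ### §1 The block-rotated matchings `R(a,b)` of `K_{2m}` -/

/-- **Partner map of `R(a,b)` on vertex labels** `0, …, 2m−1` (`a < b < m`): the base matching
`M₀ = {01, 23, 45, …}` with its block of pairs `a, …, b` (vertices `2a, …, 2b+1`) re-matched as
`{2a+1, 2a+2}, {2a+3, 2a+4}, …, {2b−1, 2b}` plus the long edge `{2a, 2b+1}`. [folklore] -/
def rotFun (a b x : ℕ) : ℕ :=
  if x = 2 * a then 2 * b + 1
  else if x = 2 * b + 1 then 2 * a
  else if 2 * a < x ∧ x < 2 * b + 1 then (if x % 2 = 1 then x + 1 else x - 1)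
  else if x % 2 = 0 then x + 1 else x - 1

/-- `R(a,b)` lives on `2m` labels. [folklore] -/
private theorem rotFun_lt {m a b x : ℕ} (hab : a < b) (hbm : b < m) (hx : x < 2 * m) : rotFun a b x < 2 * m := by
  unfold rotFun
  split_ifs <;> omega

set_option maxHeartbeats 400000 in -- 36-way case split closed by `omega`; measured > 100k heartbeats
/-- `R(a,b)` is an involution. [folklore] -/
private theorem rotFun_rotFun {a b : ℕ} (hab : a < b) (x : ℕ) : rotFun a b (rotFun a b x) = x := by
  unfold rotFun
  split_ifs <;> omega

/-- `R(a,b)` has no fixed point. [folklore] -/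
private theorem rotFun_ne (a b x : ℕ) : rotFun a b x ≠ x := by
  unfold rotFun
  split_ifs <;> omega


variable {m : ℕ}

/-- `R(a,b)` as a map of `Fin (2m)`. [folklore] -/
private def rotFin (m a b : ℕ) (hab : a < b) (hbm : b < m) (x : Fin (2 * m)) : Fin (2 * m) :=
  ⟨rotFun a b x, rotFun_lt hab hbm x.2⟩

/-- `R(a,b)` is an involution of `Fin (2m)`. [folklore] -/
private theorem rotFin_involutive {a b : ℕ} (hab : a < b) (hbm : b < m) :
    Function.Involutive (rotFin m a b hab hbm) :=
  fun x => Fin.ext (rotFun_rotFun hab x)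

/-- `R(a,b)` as a permutation of `Fin (2m)`. [folklore] -/
def rotPerm (m a b : ℕ) (hab : a < b) (hbm : b < m) : Perm (Fin (2 * m)) :=
  Function.Involutive.toPerm (rotFin m a b hab hbm) (rotFin_involutive hab hbm)

/-- Values of `R(a,b)`. [folklore] -/
@[simp] private theorem rotPerm_apply_val {a b : ℕ} (hab : a < b) (hbm : b < m) (x : Fin (2 * m)) :
    ((rotPerm m a b hab hbm x : Fin (2 * m)) : ℕ) = rotFun a b x := rfl

/-- `R(a,b)` is a fixed-point-free involution. [folklore] -/
private theorem rotPerm_mem {a b : ℕ} (hab : a < b) (hbm : b < m) : rotPerm m a b hab hbm ∈ fpfInvolutions (2 * m) := by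
  rw [mem_fpfInvolutions]
  refine ⟨Equiv.ext fun x => ?_, fun x hx => ?_⟩
  · rw [Perm.mul_apply, Perm.one_apply]
    exact rotFin_involutive hab hbm x
  · exact rotFun_ne a b x (congrArg Fin.val hx)

/-- **The perfect matching `R(a,b)` of `K_{2m}`** (a column of the odd-cut slack matrix). [folklore] -/
def rotMatch (m a b : ℕ) (hab : a < b) (hbm : b < m) : PMatch (2 * m) :=
  ⟨edgesOf (rotPerm m a b hab hbm), isPMOn_edgesOf (rotPerm_mem hab hbm)⟩

/-! ### §2 The rows: odd intervals `{2p+1, …, 2q+1}` -/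

/-- The interval of labels `2p+1, …, 2q+1` in `Fin (2m)` (`q < m`). [folklore] -/
def ivl (m p q : ℕ) (hqm : q < m) : Finset (Fin (2 * m)) :=
  (Finset.Icc (2 * p + 1) (2 * q + 1)).attachFin fun x hx => by
    have := (Finset.mem_Icc.1 hx).2
    omega

/-- Membership in the interval. [folklore] -/
private theorem mem_ivl {p q : ℕ} {hqm : q < m} {x : Fin (2 * m)} :
    x ∈ ivl m p q hqm ↔ 2 * p + 1 ≤ (x : ℕ) ∧ (x : ℕ) ≤ 2 * q + 1 := by
  rw [ivl, Finset.mem_attachFin, Finset.mem_Icc]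

/-- The interval has `2(q − p) + 1` elements. [folklore] -/
private theorem card_ivl {p q : ℕ} (hpq : p ≤ q) (hqm : q < m) : (ivl m p q hqm).card = 2 * (q - p) + 1 := by
  rw [ivl, Finset.card_attachFin, Nat.card_Icc]
  omega

/-- **The odd set `U(p,q) = {2p+1, …, 2q+1}`** (`p ≤ q < m`), a row of the odd-cut slack matrix of
`K_{2m}`; for `p < q ≤ m − 2` its size `2(q−p)+1` lies in `[3, 2m − 3]`, i.e. it is a genuine
Edmonds odd-set constraint. [folklore] -/
def oddIvl (m p q : ℕ) (hpq : p ≤ q) (hqm : q < m) : OddSet (2 * m) :=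
  ⟨ivl m p q hqm, by rw [card_ivl hpq hqm]; exact ⟨q - p, rfl⟩⟩

/-! ### §3 Crossing numbers `|δ(U(p,q)) ∩ R(a,b)|`: three if `p < a ≤ q < b`, one otherwise -/

/-- In the non-killed case, the unique vertex of `U(p,q)` matched outside `U(p,q)` by `R(a,b)`
(on labels): the right end `2q+1` if `U ⊆` block, the block's right end `2b+1` if `U` sticks out of
the block to the right, the left end `2p+1` otherwise. [folklore] -/
private def exitVertex (a b p q : ℕ) : ℕ :=
  if a ≤ p ∧ q ≤ b then 2 * q + 1 else if a ≤ p ∧ p ≤ b ∧ b < q then 2 * b + 1 else 2 * p + 1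

/-- The exit vertex lies in `U(p,q)`. [folklore] -/
private theorem exitVertex_mem {a b p q : ℕ} (hpq : p < q) :
    2 * p + 1 ≤ exitVertex a b p q ∧ exitVertex a b p q ≤ 2 * q + 1 := by
  unfold exitVertex
  split_ifs <;> omega

/-- The exit vertex is matched outside `U(p,q)`. [folklore] -/
private theorem rotFun_exitVertex_not_mem {a b p q : ℕ} (hab : a < b) :
    rotFun a b (exitVertex a b p q) < 2 * p + 1 ∨ 2 * q + 1 < rotFun a b (exitVertex a b p q) := by
  unfold exitVertex rotFun
  split_ifs <;> omega

/-- **Uniqueness of the exit vertex** when `¬(p < a ≤ q < b)`: any vertex of `U(p,q)` matched outside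
`U(p,q)` by `R(a,b)` is the exit vertex. [folklore] -/
private theorem eq_exitVertex {a b p q x : ℕ} (hab : a < b) (hpq : p < q) (hk : ¬(p < a ∧ a ≤ q ∧ q < b))
    (hx1 : 2 * p + 1 ≤ x) (hx2 : x ≤ 2 * q + 1)
    (hout : rotFun a b x < 2 * p + 1 ∨ 2 * q + 1 < rotFun a b x) : x = exitVertex a b p q := by
  unfold exitVertex
  unfold rotFun at hout
  split_ifs at hout ⊢ <;> omega

/-- **Tight pairs**: if `¬(p < a ≤ q < b)` then `|δ(U(p,q)) ∩ R(a,b)| = 1` — the matching `R(a,b)` is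
tight for the odd-set constraint of `U(p,q)` (crossing number `cc` of the Rothvoß files; the computation for
this explicit family is ours). [cite: Rothvoss2017, §2 (PDF p. 5)] -/
theorem cc_oddIvl_rotMatch_eq_one {a b p q : ℕ} (hab : a < b) (hbm : b < m) (hpq : p < q) (hqm : q < m)
    (hk : ¬(p < a ∧ a ≤ q ∧ q < b)) : cc (oddIvl m p q hpq.le hqm) (rotMatch m a b hab hbm) = 1 := by
  have hvlt : exitVertex a b p q < 2 * m := by
    have := (exitVertex_mem (a := a) (b := b) hpq).2
    omega
  let v : Fin (2 * m) := ⟨exitVertex a b p q, hvlt⟩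
  have hvU : v ∈ ivl m p q hqm := mem_ivl.2 (exitVertex_mem hpq)
  have hπv : rotPerm m a b hab hbm v ∉ ivl m p q hqm := by
    rw [mem_ivl, rotPerm_apply_val]
    show ¬(2 * p + 1 ≤ rotFun a b (exitVertex a b p q) ∧ rotFun a b (exitVertex a b p q) ≤ 2 * q + 1)
    have := rotFun_exitVertex_not_mem (p := p) (q := q) hab
    omega
  have huniq : ∀ x ∈ ivl m p q hqm, rotPerm m a b hab hbm x ∉ ivl m p q hqm → x = v := by
    intro x hx hout
    rw [mem_ivl] at hx
    rw [mem_ivl, rotPerm_apply_val] at hout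
    refine Fin.ext ?_
    show (x : ℕ) = exitVertex a b p q
    exact eq_exitVertex hab hpq hk hx.1 hx.2 (by omega)
  unfold cc
  rw [show (rotMatch m a b hab hbm).1 = edgesOf (rotPerm m a b hab hbm) from rfl,
    show (oddIvl m p q hpq.le hqm).1 = ivl m p q hqm from rfl,
    filter_crosses_edgesOf_eq (rotPerm_mem hab hbm) _ hvU hπv huniq, Finset.card_singleton]

/-- **Non-tight pairs**: if `p < a ≤ q < b` then `|δ(U(p,q)) ∩ R(a,b)| ≥ 2` (in fact `= 3`: the
labels `2p+1`, `2a`, `2q+1` are matched outside `U(p,q)`), so the slack `|δ(U) ∩ M| − 1` is non-zero there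
(crossing number `cc` of the Rothvoß files; the computation for this explicit family is ours).
[cite: Rothvoss2017, §2 (PDF p. 5)] -/
theorem two_le_cc_oddIvl_rotMatch {a b p q : ℕ} (hab : a < b) (hbm : b < m) (hpq : p < q) (hqm : q < m)
    (hk : p < a ∧ a ≤ q ∧ q < b) : 2 ≤ cc (oddIvl m p q hpq.le hqm) (rotMatch m a b hab hbm) := by
  let x : Fin (2 * m) := ⟨2 * p + 1, by omega⟩
  let y : Fin (2 * m) := ⟨2 * a, by omega⟩
  have hx : x ∈ ivl m p q hqm := mem_ivl.2 ⟨le_rfl, by show 2 * p + 1 ≤ 2 * q + 1; omega⟩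
  have hy : y ∈ ivl m p q hqm := mem_ivl.2 ⟨by show 2 * p + 1 ≤ 2 * a; omega, by show 2 * a ≤ 2 * q + 1; omega⟩
  have hxy : x ≠ y := fun h => by have := congrArg Fin.val h; simp [x, y] at this; omega
  have hπx : rotPerm m a b hab hbm x ∉ ivl m p q hqm := by
    rw [mem_ivl, rotPerm_apply_val]
    show ¬(2 * p + 1 ≤ rotFun a b (2 * p + 1) ∧ rotFun a b (2 * p + 1) ≤ 2 * q + 1)
    unfold rotFun
    split_ifs <;> omega
  have hπy : rotPerm m a b hab hbm y ∉ ivl m p q hqm := by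
    rw [mem_ivl, rotPerm_apply_val]
    show ¬(2 * p + 1 ≤ rotFun a b (2 * a) ∧ rotFun a b (2 * a) ≤ 2 * q + 1)
    unfold rotFun
    split_ifs <;> omega
  unfold cc
  exact two_le_card_filter_crosses_edgesOf (rotPerm_mem hab hbm) (ivl m p q hqm) hx hy hxy hπx hπy

/-! ### §4 The index set of the pattern: pairs `p < q < k` -/

/-- Swapping the coordinates of a (non-dependent) sigma pair is injective. [folklore] -/
private theorem swap_injective : Function.Injective (fun x : (Σ _ : ℕ, ℕ) => (x.2, x.1)) := by
  rintro ⟨q, p⟩ ⟨q', p'⟩ h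
  simp only [Prod.mk.injEq] at h
  obtain ⟨rfl, rfl⟩ := h
  rfl

/-- The pairs `(p, q)` with `p < q < k`. [folklore] -/
private def pairIdx (k : ℕ) : Finset (ℕ × ℕ) :=
  ((Finset.range k).sigma fun q => Finset.range q).map ⟨fun x => (x.2, x.1), swap_injective⟩

/-- Membership in `pairIdx`. [folklore] -/
private theorem mem_pairIdx {k : ℕ} {x : ℕ × ℕ} : x ∈ pairIdx k ↔ x.1 < x.2 ∧ x.2 < k := by
  constructor
  · intro h
    rw [pairIdx, Finset.mem_map] at h
    obtain ⟨⟨q, p⟩, hy, rfl⟩ := h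
    rw [Finset.mem_sigma, Finset.mem_range, Finset.mem_range] at hy
    exact ⟨hy.2, hy.1⟩
  · rintro ⟨h1, h2⟩
    rw [pairIdx, Finset.mem_map]
    exact ⟨⟨x.2, x.1⟩, by rw [Finset.mem_sigma, Finset.mem_range, Finset.mem_range]; exact ⟨h2, h1⟩, rfl⟩

/-- `|pairIdx k| = C(k, 2)`. [folklore] -/
private theorem card_pairIdx (k : ℕ) : (pairIdx k).card = k.choose 2 := by
  rw [pairIdx, Finset.card_map, Finset.card_sigma]
  simp only [Finset.card_range]
  have h := Finset.sum_range_id_mul_two k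
  rw [Nat.choose_two_right]
  omega

/-! ### §5 The fooling set and the psd-rank floor -/

/-- Slack zero iff tight: `S_{UM} = 0 ↔ |δ(U) ∩ M| = 1`. [cite: Rothvoss2017, §2 (PDF p. 5)] -/
theorem pmOddCutSlack_eq_zero_iff {n : ℕ} (U : OddSet n) (M : PMatch n) :
    pmOddCutSlack n U M = 0 ↔ cc U M = 1 := by
  rw [pmOddCutSlack_apply, sub_eq_zero]
  exact_mod_cast Iff.rfl

/-- `|δ(U) ∩ M| ≥ 1` for odd `U` (parity). [cite: Rothvoss2017, §1 (PDF p. 4)] -/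
theorem one_le_cc {n : ℕ} (U : OddSet n) (M : PMatch n) : 1 ≤ cc U M := by
  obtain ⟨e, he, hc⟩ := M.2.exists_crossing U.2
  exact Finset.card_pos.2 ⟨e, Finset.mem_filter.2 ⟨he, hc⟩⟩

/-- The odd-cut slack matrix is entrywise nonnegative. [cite: Rothvoss2017, §1 (PDF p. 4)] -/
theorem pmOddCutSlack_nonneg {n : ℕ} (U : OddSet n) (M : PMatch n) : 0 ≤ pmOddCutSlack n U M := by
  rw [pmOddCutSlack_apply, sub_nonneg]
  exact_mod_cast one_le_cc U M

/-- Row of the pattern at index `(p, q)`: `U(p,q)` (junk row `U(0,1)` off the index set). [folklore] -/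
private def rowOf (m : ℕ) (hm : 3 ≤ m) (x : ℕ × ℕ) : OddSet (2 * m) :=
  if h : x.1 < x.2 ∧ x.2 < m - 1 then oddIvl m x.1 x.2 h.1.le (by omega)
  else oddIvl m 0 1 zero_le_one (by omega)

/-- Column of the pattern at index `(p, q)`: `R(p+1, q+1)` (junk column off the index set). [folklore] -/
private def colOf (m : ℕ) (hm : 3 ≤ m) (x : ℕ × ℕ) : PMatch (2 * m) :=
  if h : x.1 < x.2 ∧ x.2 < m - 1 then rotMatch m (x.1 + 1) (x.2 + 1) (by omega) (by omega)
  else rotMatch m 0 1 zero_lt_one (by omega)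

/-- **An explicit support-based certificate of order `n²`.** For `n = 2m`, the pairs
`(U(p,q), R(p+1,q+1))`, `0 ≤ p < q ≤ m − 2`, ordered by decreasing `(p,q)` (lexicographically),
form a triangular pattern in the odd-cut slack matrix `S` of the perfect matching polytope of `K_n`:
`S(U(p,q), R(p+1,q+1)) = 2 ≠ 0` and `S(U(p,q), R(p'+1,q'+1)) = 0` whenever `(p',q') <_lex (p,q)`.
Hence EVERY nonnegative matrix with the support of `S` has psd rank `≥ C(m−1, 2)`:
`IsSupportBasedPsdBound (2m) (C(m−1,2))` — the technique class bounded above by `C(n,2)+1` in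
`supportBasedPsdBound_le` does certify `Ω(n²)`. [cite: FawziEtAl2015, §5.2 (p15); Thm. 2.10 + Ex. 2.11 (p07)] -/
theorem isSupportBasedPsdBound_choose_two (m : ℕ) : IsSupportBasedPsdBound (2 * m) ((m - 1).choose 2) := by
  intro N hN hsupp r hr hfac
  rcases lt_or_ge m 3 with hm | hm
  · have : (m - 1).choose 2 = 0 := Nat.choose_eq_zero_of_lt (by omega)
    omega
  have key : (pairIdx (m - 1)).card ≤ r := by
    refine card_le_of_triangular_code hfac (pairIdx (m - 1)) (fun x => x.2 + (m - 1) * x.1) ?_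
      (rowOf m hm) (colOf m hm) ?_ ?_
    · -- the code `q + (m−1)·p` is injective on pairs with `q < m − 1`
      intro x hx y hy hxy
      have hx' := (mem_pairIdx.1 (Finset.mem_coe.1 hx)).2
      have hy' := (mem_pairIdx.1 (Finset.mem_coe.1 hy)).2
      have h0 : 0 < m - 1 := by omega
      have h1 : x.1 = y.1 := by
        have := congrArg (· / (m - 1)) hxy
        simpa [Nat.add_mul_div_left _ _ h0, Nat.div_eq_of_lt hx', Nat.div_eq_of_lt hy'] using this
      have h2 : x.2 = y.2 := by
        have := congrArg (· % (m - 1)) hxy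
        simpa [Nat.add_mul_mod_self_left, Nat.mod_eq_of_lt hx', Nat.mod_eq_of_lt hy'] using this
      exact Prod.ext h1 h2
    · -- diagonal: `R(p+1,q+1)` crosses `U(p,q)` three times
      intro x hx
      have hx' := mem_pairIdx.1 hx
      intro h0
      have h1 : cc (rowOf m hm x) (colOf m hm x) = 1 :=
        (pmOddCutSlack_eq_zero_iff _ _).1 ((hsupp _ _).1 h0)
      have h2 : 2 ≤ cc (rowOf m hm x) (colOf m hm x) := by
        simp only [rowOf, colOf, dif_pos hx']
        exact two_le_cc_oddIvl_rotMatch _ _ hx'.1 _ ⟨by omega, by omega, by omega⟩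
      omega
    · -- off-diagonal: a column with a smaller code is tight on the row
      intro x hx y hy hcode
      have hx' := mem_pairIdx.1 hx
      have hy' := mem_pairIdx.1 hy
      rw [hsupp, pmOddCutSlack_eq_zero_iff]
      simp only [rowOf, colOf, dif_pos hx', dif_pos hy']
      refine cc_oddIvl_rotMatch_eq_one _ _ hx'.1 _ ?_
      rintro ⟨hk1, hk2, hk3⟩
      -- `p_x ≤ p_y` and `q_x ≤ q_y` would make the code of `x` at most the code of `y`
      have hle : x.2 + (m - 1) * x.1 ≤ y.2 + (m - 1) * y.1 :=
        Nat.add_le_add (by omega) (Nat.mul_le_mul_left _ (by omega))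
      omega
  rw [card_pairIdx] at key
  omega

/-- **Unconditional psd-rank floor for Edmonds' odd-cut slack matrix**: every psd factorisation of
`S_{UM} = |δ(U) ∩ M| − 1` on (odd sets) × (perfect matchings of `K_{2m}`) has size `≥ C(m − 1, 2)`
(`≈ n²/8`), by the explicit fooling set — no description of the matching polytope is used.
[cite: FawziEtAl2015, Thm. 2.10 + Ex. 2.11 (p07); §5.2 (p15)] -/
theorem choose_two_le_of_hasPsdFactorization {r : ℕ} (h : HasPsdFactorization (pmOddCutSlack (2 * m)) r) :
    (m - 1).choose 2 ≤ r := by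
  by_contra hlt
  exact isSupportBasedPsdBound_choose_two m (pmOddCutSlack (2 * m)) (fun U M => pmOddCutSlack_nonneg U M)
    (fun U M => Iff.rfl) r (lt_of_not_ge hlt) h

/-- The same floor for even `n`, in the `n`-indexed form: psd rank of the odd-cut slack matrix of
`K_n` is at least `C(n/2 − 1, 2)`. [cite: FawziEtAl2015, Thm. 2.10 + Ex. 2.11 (p07); §5.2 (p15)] -/
theorem choose_two_le_of_hasPsdFactorization_even {n r : ℕ} (hn : Even n)
    (h : HasPsdFactorization (pmOddCutSlack n) r) : (n / 2 - 1).choose 2 ≤ r := by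
  obtain ⟨m, rfl⟩ := hn
  rw [← two_mul] at h
  have := choose_two_le_of_hasPsdFactorization h
  rwa [show (m + m) / 2 = m by omega]

/-- The `n`-indexed form of the certificate: for even `n`, `IsSupportBasedPsdBound n (C(n/2 − 1, 2))`.
[cite: FawziEtAl2015, §5.2 (p15); Thm. 2.10 + Ex. 2.11 (p07)] -/
theorem isSupportBasedPsdBound_even {n : ℕ} (hn : Even n) : IsSupportBasedPsdBound n ((n / 2 - 1).choose 2) := by
  obtain ⟨m, rfl⟩ := hn
  rw [← two_mul, show 2 * m / 2 = m by omega]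
  exact isSupportBasedPsdBound_choose_two m

/-- **The support barrier is attained up to the constant `4`.** For `n = 2m` the largest psd-rank
lower bound for Edmonds' odd-cut slack matrix certifiable by a support-based argument lies between
`C(m − 1, 2) ≈ n²/8` (the fooling set above) and `C(n, 2) + 1 ≈ n²/2` (`supportBasedPsdBound_le`,
FGPRT §5.2 via `S ∘ S`). [cite: FawziEtAl2015, §5.2 (p15)] -/
theorem supportBased_window (m : ℕ) :
    IsSupportBasedPsdBound (2 * m) ((m - 1).choose 2) ∧
      ∀ R : ℕ, IsSupportBasedPsdBound (2 * m) R → R ≤ (2 * m).choose 2 + 1 :=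
  ⟨isSupportBasedPsdBound_choose_two m, fun _ h => supportBasedPsdBound_le h⟩

/-! ### §6 The ceiling of the support-based class is the dimension bound `C(n,2) − n + 1`

The barrier `supportBasedPsdBound_le` uses `rank S ≤ |E(K_n)| + 1`. The `n` degree identities
`Σ_{e ∋ v} 1[e ∈ M] = 1` (one for each vertex `v`, valid for every perfect matching `M`) are `n`
linearly independent relations among the rows of the column-factor matrix `(1[e ∈ M])_{e,M} ⊕ (1)_M`,
so `rank S ≤ C(n,2) + 1 − n` — which is `dim P_PM(K_n) + 1` (Edmonds–Lovász–Pulleyblank; not used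
here; proved in `PerfectMatchingPolytopeDimension.lean`, `PMPolytopeDim.finrank_dirSpace`) —, and by
Lee–Theis / FGPRT Thm 5.8 (`supportBased_le_rank`) every support-based bound
obeys the same ceiling: for Edmonds' slack matrix, zero-pattern arguments can never exceed the
dimension bound, and the fooling set of §5 reaches a quarter of it. -/

/-- `|E(K_n) ⊕ 1| = C(n,2) + 1`. [folklore] -/
private theorem card_edge_sum_unit (n : ℕ) : Fintype.card (Edge n ⊕ Unit) = n.choose 2 + 1 := by
  rw [Fintype.card_sum, Sym2.card_subtype_not_diag, Fintype.card_fin, Fintype.card_unit]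

/-- The degree identity at a vertex, summed over the non-loop edges of `K_n`:
`Σ_{e ∈ E(K_n)} 1[e ∈ M]·1[v ∈ e] = 1` for a perfect matching `M`. [cite: Rothvoss2017, §1 (PDF p. 4)] -/
private theorem sum_edge_mem_mul_inc {n : ℕ} (M : PMatch n) (v : Fin n) :
    ∑ e : Edge n, (if e.1 ∈ M.1 then (1 : ℝ) else 0) * (if v ∈ e.1 then (1 : ℝ) else 0) = 1 := by
  classical
  have hone : (M.1.filter fun e => v ∈ e).card = 1 := M.2.card_filter (Finset.mem_univ v)
  have hset : (Finset.univ.filter fun e : Edge n => e.1 ∈ M.1 ∧ v ∈ e.1) =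
      (M.1.filter fun e => v ∈ e).subtype (fun e : Sym2 (Fin n) => ¬e.IsDiag) := by
    ext e
    simp only [Finset.mem_filter, Finset.mem_univ, true_and, Finset.mem_subtype]
  have hcard : (Finset.univ.filter fun e : Edge n => e.1 ∈ M.1 ∧ v ∈ e.1).card = 1 := by
    rw [hset, Finset.card_subtype, Finset.filter_filter]
    rw [← hone]
    congr 1
    refine Finset.filter_congr fun e he => ?_
    exact ⟨fun h => h.1, fun h => ⟨h, M.2.not_isDiag he⟩⟩
  calc ∑ e : Edge n, (if e.1 ∈ M.1 then (1 : ℝ) else 0) * (if v ∈ e.1 then (1 : ℝ) else 0)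
      = ∑ e : Edge n, (if e.1 ∈ M.1 ∧ v ∈ e.1 then (1 : ℝ) else 0) := by
        refine Finset.sum_congr rfl fun e _ => ?_
        by_cases h1 : e.1 ∈ M.1 <;> by_cases h2 : v ∈ e.1 <;> simp [h1, h2]
    _ = ((Finset.univ.filter fun e : Edge n => e.1 ∈ M.1 ∧ v ∈ e.1).card : ℝ) := by
        rw [Finset.sum_boole]
    _ = 1 := by rw [hcard]; norm_num

/-- **`rank S ≤ C(n,2) + 1 − n`** for the odd-cut slack matrix of `K_n`, `n ≥ 3`: the factorisation of
`MatchingSlackPsdSupportBarrier` through `E(K_n) ⊕ 1` has a column factor whose rows satisfy the `n`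
independent degree relations. (`C(n,2) − n = dim P_PM(K_n)`, not used.) [cite: FawziEtAl2015, §5.2 (p15); Thm. 2.9 (v) (p06–p07)] -/
theorem rank_pmOddCutSlack_le {n : ℕ} (hn : 3 ≤ n) :
    Matrix.rank (pmOddCutSlack n : Matrix (OddSet n) (PMatch n) ℝ) ≤ n.choose 2 + 1 - n := by
  classical
  set Rm : Matrix (OddSet n) (Edge n ⊕ Unit) ℝ := Matrix.of fun U x => rowFactor U x with hRm
  set Cm : Matrix (Edge n ⊕ Unit) (PMatch n) ℝ := Matrix.of fun x M => colFactor M x with hCm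
  have hfac : (pmOddCutSlack n : Matrix (OddSet n) (PMatch n) ℝ) = Rm * Cm := by
    ext U M
    rw [Matrix.mul_apply, pmOddCutSlack_eq_sum_factor]
    rfl
  -- the `n` degree relations, as vectors of `ℝ^{E(K_n) ⊕ 1}` in the left kernel of `Cm`
  let rel : Fin n → (Edge n ⊕ Unit → ℝ) := fun v => Sum.elim (fun e => if v ∈ e.1 then (1 : ℝ) else 0) (fun _ => -1)
  set f : (Edge n ⊕ Unit → ℝ) →ₗ[ℝ] (PMatch n → ℝ) := Matrix.mulVecLin Cm.transpose with hf
  have hker : ∀ v, rel v ∈ LinearMap.ker f := by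
    intro v
    rw [LinearMap.mem_ker, hf, Matrix.mulVecLin_apply]
    funext M
    rw [Matrix.mulVec, dotProduct, Fintype.sum_sum_type, Pi.zero_apply]
    simp only [Matrix.transpose_apply, hCm, Matrix.of_apply, colFactor, rel, Sum.elim_inl, Sum.elim_inr,
      Finset.sum_const, Finset.card_univ, Fintype.card_unit, one_smul, mul_neg, mul_one]
    rw [sum_edge_mem_mul_inc M v]
    norm_num
  have hli : LinearIndependent ℝ rel := by
    rw [Fintype.linearIndependent_iff]
    intro c hc
    -- evaluate the vanishing combination at the edge `{u, w}`: `c u + c w = 0`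
    have key : ∀ u w : Fin n, u ≠ w → c u + c w = 0 := by
      intro u w huw
      have h := congrFun hc (Sum.inl ⟨s(u, w), by rwa [Sym2.mk_isDiag_iff]⟩)
      simp only [Finset.sum_apply, Pi.smul_apply, smul_eq_mul, rel, Sum.elim_inl, Pi.zero_apply,
        mul_ite, mul_one, mul_zero] at h
      rw [← Finset.sum_filter] at h
      have hfilt : (Finset.univ.filter fun v : Fin n => v ∈ s(u, w)) = {u, w} := by
        ext v; simp [Sym2.mem_iff]
      rw [hfilt, Finset.sum_pair huw] at h
      exact h
    intro v
    -- two further distinct vertices exist since `n ≥ 3`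
    obtain ⟨u, hu⟩ : ∃ u : Fin n, u ≠ v := by
      by_cases hv : (v : ℕ) = 0
      · exact ⟨⟨1, by omega⟩, fun h => by have := congrArg Fin.val h; simp at this; omega⟩
      · exact ⟨⟨0, by omega⟩, fun h => by have := congrArg Fin.val h; simp at this; omega⟩
    obtain ⟨z, hzv, hzu⟩ : ∃ z : Fin n, z ≠ v ∧ z ≠ u := by
      have h3 : ∀ a b : Fin n, ∃ z : Fin n, z ≠ a ∧ z ≠ b := by
        intro a b
        by_cases h0 : (a : ℕ) ≠ 0 ∧ (b : ℕ) ≠ 0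
        · exact ⟨⟨0, by omega⟩, fun h => h0.1 (by rw [← h]), fun h => h0.2 (by rw [← h])⟩
        by_cases h1 : (a : ℕ) ≠ 1 ∧ (b : ℕ) ≠ 1
        · exact ⟨⟨1, by omega⟩, fun h => h1.1 (by rw [← h]), fun h => h1.2 (by rw [← h])⟩
        · refine ⟨⟨2, by omega⟩, fun h => ?_, fun h => ?_⟩
          · have := congrArg Fin.val h; simp at this; omega
          · have := congrArg Fin.val h; simp at this; omega
      exact h3 v u
    have h1 := key v u hu.symm
    have h2 := key v z hzv.symm
    have h3 := key u z hzu.symm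
    linarith
  -- rank–nullity for `Cm.transpose`
  have hrank : Cm.rank + n ≤ Fintype.card (Edge n ⊕ Unit) := by
    have hrn := LinearMap.finrank_range_add_finrank_ker f
    rw [Module.finrank_pi] at hrn
    have hkerge : n ≤ Module.finrank ℝ (LinearMap.ker f) := by
      let rel' : Fin n → LinearMap.ker f := fun v => ⟨rel v, hker v⟩
      have hli' : LinearIndependent ℝ rel' :=
        LinearIndependent.of_comp (LinearMap.ker f).subtype (by exact hli)
      simpa using hli'.fintype_card_le_finrank
    have hCt : Cm.rank = Module.finrank ℝ (LinearMap.range f) := by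
      rw [hf, ← Matrix.rank_transpose Cm]; rfl
    omega
  calc Matrix.rank (pmOddCutSlack n : Matrix (OddSet n) (PMatch n) ℝ)
      = (Rm * Cm).rank := by rw [hfac]
    _ ≤ Cm.rank := Matrix.rank_mul_le_right _ _
    _ ≤ n.choose 2 + 1 - n := by rw [card_edge_sum_unit] at hrank; omega

/-- **The support barrier, sharpened to the dimension bound.** Every support-based psd-rank lower bound
`R` for the odd-cut slack matrix of `K_n` (`n ≥ 3`) satisfies `R ≤ C(n,2) + 1 − n = dim P_PM(K_n) + 1`
(Lee–Theis: support-based bounds never exceed the rank). [cite: FawziEtAl2015, §5.2 (p15); Thm. 5.8] -/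
theorem supportBasedPsdBound_le_dim {n R : ℕ} (hn : 3 ≤ n) (h : IsSupportBasedPsdBound n R) :
    R ≤ n.choose 2 + 1 - n :=
  (supportBased_le_rank (pmOddCutSlack n : Matrix (OddSet n) (PMatch n) ℝ) h).trans (rank_pmOddCutSlack_le hn)

/-- **The support-based window for Edmonds' slack matrix of `K_{2m}`, `m ≥ 2`:** certificates of size
`C(m − 1, 2)` exist (§5) and none exceeds `C(2m, 2) + 1 − 2m` — between a quarter of the dimension bound
and the dimension bound itself. [cite: FawziEtAl2015, §5.2 (p15); Thm. 2.10 + Ex. 2.11 (p07); Thm. 5.8] -/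
theorem supportBased_window_dim {m : ℕ} (hm : 2 ≤ m) :
    IsSupportBasedPsdBound (2 * m) ((m - 1).choose 2) ∧
      ∀ R : ℕ, IsSupportBasedPsdBound (2 * m) R → R ≤ (2 * m).choose 2 + 1 - 2 * m :=
  ⟨isSupportBasedPsdBound_choose_two m, fun _ h => supportBasedPsdBound_le_dim (by omega) h⟩

end PsdFoolingSet

end Literature.Barriers.PneNP
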